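import Literature.Algebra.EuclideanLattices.LLLMachineTables
import HarnessLib

/-!
# The LLL machine, II: the `d`- and `λ`-tables of a matrix, `RED(k,l)`, and the saturated LLL pass

Trunk: Lattice; continues `LLLMachineTables.lean` (codes, the saturated Gram table `gramF`, one level
of Cohen's recursion `levelF`) towards `lllReduce_polyTime`. Here the string functions realising the
saturated integral step `capStep W` of `LLLCapModel.lean`:

* `tablesF ⟨x, ⟨bin n, ⟨bin k, matCode b⟩⟩⟩ = ⟨dListCode W b, lamListCode W b k⟩` — running Cohen's
  recursion through all levels `l = 0, …, n-1` (a counted loop over `levelF`) and recording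
  `dₗ₊₁ = uₗ(l,l)` and `λₖₗ = uₗ(k,l)` (`W = |x|`);
* `redF` — the size reduction `RED(k,l)` of the machine (`sizeReduceCap`): read `λ = λₖₗ`,
  `d = dₗ₊₁` off the tables; if `2|λ| ≤ d` keep the matrix, else replace row `k` by the saturated
  row `bₖ - q bₗ`, `q = (2λ + d)/(2d)`;
* `redLoopF` — the descending loop `RED(k,k-2), …, RED(k,0)` (`sizeReduceFromCap`);
* `capStepF ⟨x, ⟨bin n, ⟨matCode b, bin k⟩⟩⟩ = ⟨matCode b', bin k'⟩` where `⟨b', k'⟩ = capStep |x| ⟨b, k⟩`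
  — `RED(k,k-1)`, the integral Lovász test `3dₖ² ≤ 4(dₖ₊₁dₖ₋₁ + λ²)`, then the descending loop and
  `k+1`, or the exchange of rows `k-1, k` and `max(1,k-1)`.

Every function comes with membership in `FP` and an all-input output bound of the form
`|out| ≤ |matrix| + G(|x|)` (the tables are *absolutely* bounded by a polynomial of `|x|`), which is
what the main loop (`LLLMachineMain.lean`) needs.

## References

* A. K. Lenstra, H. W. Lenstra Jr., L. Lovász, Math. Ann. 261 (1982), §1 Fig. 1 and Prop. 1.26.
* H. Cohen, *A Course in Computational Algebraic Number Theory*, GTM 138, 1993, Algorithm 2.6.7.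
* S. Arora, B. Barak, *Computational Complexity: A Modern Approach*, CUP 2009, §1.3.
-/

noncomputable section

namespace Literature.Algebra.EuclideanLattices

open _root_.Computability Literature.Computability.Complexity Literature.Computability.Complexity.Brick Polynomial

namespace LLLMachine

variable {n : ℕ}

/-! ### Codes of the `d`-list and the `λ`-list -/

/-- The code of the saturated `d`-list `d₀, …, dₙ`. [cite: Cohen1993, Algorithm 2.6.7] -/
def dListCode (W : ℕ) (b : Fin n → (Fin n → ℤ)) : List Bool := zlist ((List.range (n + 1)).map (dRecCap W b))

/-- The code of the saturated `λ`-row of index `k`: `λₖₗ = uₗ(k,l)` for `l < n` (junk `0` for `k ≥ n`).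
[cite: Cohen1993, Algorithm 2.6.7] -/
def lamListCode (W : ℕ) (b : Fin n → (Fin n → ℤ)) (k : ℕ) : List Bool := zlist ((List.range n).map fun l => uCapN W b l k l)

/-- An item of the `d`-list. [folklore] -/
theorem dListCode_getD (W : ℕ) (b : Fin n → (Fin n → ℤ)) {t : ℕ} (ht : t ≤ n) :
    (((List.range (n + 1)).map (dRecCap W b)).map dpEnc).getD t [] = dpEnc (dRecCap W b t) := by
  rw [getD_map_dpEnc _ _ (by simp; omega)]; simp [List.getElem_range]

/-- An item of the `λ`-list. [folklore] -/
theorem lamListCode_getD (W : ℕ) (b : Fin n → (Fin n → ℤ)) (k : ℕ) {l : ℕ} (hl : l < n) :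
    (((List.range n).map fun l => uCapN W b l k l).map dpEnc).getD l [] = dpEnc (uCapN W b l k l) := by
  rw [getD_map_dpEnc _ _ (by simp; omega)]; simp

/-! ### The tables loop -/

/-- The successor of the level field (field `4` of the loop record). [folklore] -/
def succLLF : List Bool → List Bool := addFn ∘ fanoutFn (nthF 4) (fun _ => [true])

/-- The next `d`: `zcapF ⟨x, U[l][l]⟩` (fields of the loop record: `x:0`, `ll:4`, `U:5`). [folklore] -/
def tabDnewF : List Bool → List Bool :=
  zcapF ∘ fanoutFn (nthF 0) (nthLF ∘ fanoutFn (nthF 0) (fanoutFn (nthF 4) (nthLF ∘ fanoutFn (nthF 0) (fanoutFn (nthF 4) (nthF 5)))))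

/-- The next `λ`: `zcapF ⟨x, U[k][l]⟩` (`kk:3`). [folklore] -/
def tabLamF : List Bool → List Bool :=
  zcapF ∘ fanoutFn (nthF 0) (nthLF ∘ fanoutFn (nthF 0) (fanoutFn (nthF 4) (nthLF ∘ fanoutFn (nthF 0) (fanoutFn (nthF 3) (nthF 5)))))

/-- The next table: `levelF ⟨x, ⟨nn, ⟨ll, ⟨dl, U⟩⟩⟩⟩` (`nn:2`, `dl:6`). [folklore] -/
def tabLevelF : List Bool → List Bool :=
  levelF ∘ fanoutFn (nthF 0) (fanoutFn (nthF 2) (fanoutFn (nthF 4) (fanoutFn (nthF 6) (nthF 5))))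

/-- **The body of the tables loop** on `⟨x, ⟨cnt, ⟨nn, ⟨kk, ⟨ll, ⟨U, ⟨dl, ⟨dAcc, lamAcc⟩⟩⟩⟩⟩⟩⟩⟩`:
`⟨nn, ⟨kk, ⟨ll+1, ⟨U', ⟨d', ⟨d' :: dAcc, λ :: lamAcc⟩⟩⟩⟩⟩⟩`. [cite: Cohen1993, Algorithm 2.6.7 Step 2] -/
def tabBody : List Bool → List Bool :=
  fanoutFn (nthF 2) (fanoutFn (nthF 3) (fanoutFn succLLF (fanoutFn tabLevelF (fanoutFn tabDnewF
    (fanoutFn (fanoutFn tabDnewF (nthF 7)) (fanoutFn tabLamF (sndPow 7)))))))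

/-- `tabBody ∈ FP`. [folklore] -/
theorem tabBody_mem_FP : tabBody ∈ FP := by
  have hD : tabDnewF ∈ FP :=
    comp_mem_FP zcapF_mem_FP (fanoutFn_mem_FP (nthF_mem_FP 0) (comp_mem_FP nthLF_mem_FP (fanoutFn_mem_FP (nthF_mem_FP 0)
      (fanoutFn_mem_FP (nthF_mem_FP 4) (comp_mem_FP nthLF_mem_FP (fanoutFn_mem_FP (nthF_mem_FP 0) (fanoutFn_mem_FP (nthF_mem_FP 4) (nthF_mem_FP 5))))))))
  have hL : tabLamF ∈ FP :=
    comp_mem_FP zcapF_mem_FP (fanoutFn_mem_FP (nthF_mem_FP 0) (comp_mem_FP nthLF_mem_FP (fanoutFn_mem_FP (nthF_mem_FP 0)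
      (fanoutFn_mem_FP (nthF_mem_FP 4) (comp_mem_FP nthLF_mem_FP (fanoutFn_mem_FP (nthF_mem_FP 0) (fanoutFn_mem_FP (nthF_mem_FP 3) (nthF_mem_FP 5))))))))
  have hT : tabLevelF ∈ FP :=
    comp_mem_FP levelF_mem_FP (fanoutFn_mem_FP (nthF_mem_FP 0) (fanoutFn_mem_FP (nthF_mem_FP 2) (fanoutFn_mem_FP (nthF_mem_FP 4) (fanoutFn_mem_FP (nthF_mem_FP 6) (nthF_mem_FP 5)))))
  have hS : succLLF ∈ FP := comp_mem_FP addFn_mem_FP (fanoutFn_mem_FP (nthF_mem_FP 4) (const_mem_FP _))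
  exact fanoutFn_mem_FP (nthF_mem_FP 2) (fanoutFn_mem_FP (nthF_mem_FP 3) (fanoutFn_mem_FP hS (fanoutFn_mem_FP hT (fanoutFn_mem_FP hD
    (fanoutFn_mem_FP (fanoutFn_mem_FP hD (nthF_mem_FP 7)) (fanoutFn_mem_FP hL (sndPow_mem_FP 7)))))))

/-- `tabDnewF` saturates. [folklore] -/
theorem length_tabDnewF_le (z : List Bool) : (tabDnewF z).length ≤ 2 * (fstF z).length + 2 := by
  rw [tabDnewF, Function.comp_apply, fanoutFn_apply]
  exact (length_zcapF_le _).trans (by simp)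

/-- `tabLamF` saturates. [folklore] -/
theorem length_tabLamF_le (z : List Bool) : (tabLamF z).length ≤ 2 * (fstF z).length + 2 := by
  rw [tabLamF, Function.comp_apply, fanoutFn_apply]
  exact (length_zcapF_le _).trans (by simp)

/-- `tabLevelF` has absolutely bounded output. [folklore] -/
theorem length_tabLevelF_le (z : List Bool) :
    (tabLevelF z).length ≤ (fstF z).length * (2 * ((fstF z).length * (4 * (fstF z).length + 8)) + 4) := by
  rw [tabLevelF, Function.comp_apply]
  exact (length_levelF_le _).trans (by simp)

/-- `succLLF` adds at most two symbols to the level field. [folklore] -/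
theorem length_succLLF_le (z : List Bool) : (succLLF z).length ≤ (nthF 4 z).length + 2 := by
  have e : succLLF z = encodeNat (bitsToNat (nthF 4 z) + 1) := by simp [succLLF]
  rw [e]
  refine (_root_.Literature.Computability.Complexity.length_encodeNat_add_le _ _).trans ?_
  have h1 := length_encodeNat_bitsToNat_le (nthF 4 z)
  have h2 : (encodeNat 1).length = 1 := by decide
  rw [h2]; omega

/-- The growth polynomial of the tables body. [folklore] -/
def tabGrowth : Polynomial ℕ := 2 * (X * (2 * (X * (4 * X + 8)) + 4)) + 16 * X + 38

/-- **Growth of the tables body**: `≤ |state| + tabGrowth(|x|)`. [folklore] -/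
theorem length_tabBody_le (z : List Bool) : (tabBody z).length ≤ (sndPow 1 z).length + tabGrowth.eval (fstF z).length := by
  have c1 := length_nthF_succ_add_sndPow_succ_le 1 z
  have c2 := length_nthF_succ_add_sndPow_succ_le 2 z
  have c3 := length_nthF_succ_add_sndPow_succ_le 3 z
  have c4 := length_nthF_succ_add_sndPow_succ_le 4 z
  have c5 := length_nthF_succ_add_sndPow_succ_le 5 z
  have c6 := length_nthF_succ_add_sndPow_succ_le 6 z
  have hD := length_tabDnewF_le z
  have hL := length_tabLamF_le z
  have hT := length_tabLevelF_le z
  have hS := length_succLLF_le z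
  simp only [Nat.reduceAdd] at c1 c2 c3 c4 c5 c6
  simp only [tabBody, fanoutFn_apply, length_boolPair, tabGrowth, eval_add, eval_mul, eval_ofNat, eval_X]
  nlinarith [Nat.zero_le (fstF z).length]

/-- The growth polynomial of the tables potential `|dAcc| + |lamAcc|`: `8|x| + 12` per round. [folklore] -/
theorem potential_tabBody (x c S : List Bool) (_hc : c ≠ []) :
    (nthF 5 (tabBody (boolPair x (boolPair c S)))).length + (sndPow 5 (tabBody (boolPair x (boolPair c S)))).length ≤
      ((nthF 5 S).length + (sndPow 5 S).length) + (8 * x.length + 12) := by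
  have hD := length_tabDnewF_le (boolPair x (boolPair c S))
  have hL := length_tabLamF_le (boolPair x (boolPair c S))
  simp only [fstF_boolPair] at hD hL
  have e5 : nthF 5 (tabBody (boolPair x (boolPair c S))) = boolPair (tabDnewF (boolPair x (boolPair c S))) (nthF 5 S) := by
    simp [tabBody, nthF, sndPow]
  have e6 : sndPow 5 (tabBody (boolPair x (boolPair c S))) = boolPair (tabLamF (boolPair x (boolPair c S))) (sndPow 5 S) := by
    simp [tabBody, nthF, sndPow]
  rw [e5, e6, length_boolPair, length_boolPair]
  omega

/-- The initial record of the tables loop from `⟨x, ⟨nn, ⟨kk, M⟩⟩⟩`: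
`⟨x, ⟨nn, ⟨nn, ⟨kk, ⟨bin 0, ⟨gramF ⟨x, ⟨nn, M⟩⟩, ⟨dpEnc 1, ⟨[dpEnc 1], []⟩⟩⟩⟩⟩⟩⟩⟩`. [folklore] -/
def tabInit : List Bool → List Bool :=
  fanoutFn (nthF 0) (fanoutFn (nthF 1) (fanoutFn (nthF 1) (fanoutFn (nthF 2) (fanoutFn (fun _ => [])
    (fanoutFn (gramF ∘ fanoutFn (nthF 0) (fanoutFn (nthF 1) (sndPow 2)))
      (fanoutFn (fun _ => dpEnc 1) (fanoutFn (fun _ => encList [dpEnc 1]) (fun _ => []))))))))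

/-- `tabInit ∈ FP`. [folklore] -/
theorem tabInit_mem_FP : tabInit ∈ FP :=
  fanoutFn_mem_FP (nthF_mem_FP 0) (fanoutFn_mem_FP (nthF_mem_FP 1) (fanoutFn_mem_FP (nthF_mem_FP 1) (fanoutFn_mem_FP (nthF_mem_FP 2)
    (fanoutFn_mem_FP (const_mem_FP _) (fanoutFn_mem_FP (comp_mem_FP gramF_mem_FP (fanoutFn_mem_FP (nthF_mem_FP 0) (fanoutFn_mem_FP (nthF_mem_FP 1) (sndPow_mem_FP 2))))
      (fanoutFn_mem_FP (const_mem_FP _) (fanoutFn_mem_FP (const_mem_FP _) (const_mem_FP _))))))))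

/-- The `d`-list read off the final record (field `7`), reversed into order (`n + 1` items). [folklore] -/
def tabDListF : List Bool → List Bool :=
  takeRevLF ∘ fanoutFn (nthF 0) (fanoutFn (addFn ∘ fanoutFn (nthF 2) (fun _ => [true])) (nthF 7))

/-- The `λ`-list read off the final record (`sndPow 7`), reversed into order (`n` items). [folklore] -/
def tabLamListF : List Bool → List Bool := takeRevLF ∘ fanoutFn (nthF 0) (fanoutFn (nthF 2) (sndPow 7))

/-- **The tables of a matrix**: `tablesF ⟨x, ⟨nn, ⟨kk, M⟩⟩⟩ = ⟨d-list, λ-list of row k⟩`.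
[cite: Cohen1993, Algorithm 2.6.7] -/
def tablesF : List Bool → List Bool := fanoutFn tabDListF tabLamListF ∘ loopX tabBody ∘ tabInit

/-- `tablesF ∈ FP`. [folklore] -/
theorem tablesF_mem_FP : tablesF ∈ FP :=
  comp_mem_FP (fanoutFn_mem_FP
      (comp_mem_FP takeRevLF_mem_FP (fanoutFn_mem_FP (nthF_mem_FP 0) (fanoutFn_mem_FP (comp_mem_FP addFn_mem_FP (fanoutFn_mem_FP (nthF_mem_FP 2) (const_mem_FP _))) (nthF_mem_FP 7))))
      (comp_mem_FP takeRevLF_mem_FP (fanoutFn_mem_FP (nthF_mem_FP 0) (fanoutFn_mem_FP (nthF_mem_FP 2) (sndPow_mem_FP 7)))))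
    (comp_mem_FP (loopX_mem_FP tabBody_mem_FP length_tabBody_le) tabInit_mem_FP)

/-! #### Semantics of the tables loop -/

/-- The state of the tables loop at level `l` with accumulators `DA`, `LA`. [folklore] -/
def tabState (x : List Bool) (b : Fin n → (Fin n → ℤ)) (k l : ℕ) (DA LA : List (List Bool)) : List Bool :=
  boolPair (encodeNat n) (boolPair (encodeNat k) (boolPair (encodeNat l) (boolPair (tableCode x.length b l)
    (boolPair (dpEnc (dRecCap x.length b l)) (boolPair (encList DA) (encList LA))))))

/-- Reading the entry `(i, j)` of a table code. [folklore] -/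
theorem nthLF_nthLF_tableCode (x : List Bool) {W : ℕ} (b : Fin n → (Fin n → ℤ)) (l : ℕ) {i j : ℕ} (hi : i < n) (hj : j < n)
    (hx : n ≤ x.length) :
    nthLF (boolPair x (boolPair (encodeNat j) (nthLF (boolPair x (boolPair (encodeNat i) (tableCode W b l)))))) =
      dpEnc (uRecCap W b l ⟨i, hi⟩ ⟨j, hj⟩) := by
  rw [tableCode, nthLF_apply x (by omega)]
  have e : (List.ofFn fun i : Fin n => zlist (List.ofFn fun j : Fin n => uRecCap W b l i j)).getD i [] =
      zlist (List.ofFn fun j : Fin n => uRecCap W b l ⟨i, hi⟩ j) := by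
    rw [List.getD_eq_getElem?_getD, List.getElem?_eq_getElem (by simpa using hi), Option.getD_some, List.getElem_ofFn]
  rw [e, zlist_eq, nthLF_apply x (by omega), getD_map_dpEnc _ _ (by simpa using hj)]
  simp

/-- **One round of the tables loop** (`l < n`, `k < n`, `n ≤ |x|`). [cite: Cohen1993, Algorithm 2.6.7 Step 2] -/
theorem tabBody_apply (x c : List Bool) (b : Fin n → (Fin n → ℤ)) {k l : ℕ} (hk : k < n) (hl : l < n) (hx : n ≤ x.length)
    (DA LA : List (List Bool)) :
    tabBody (boolPair x (boolPair c (tabState x b k l DA LA))) =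
      tabState x b k (l + 1) (dpEnc (dRecCap x.length b (l + 1)) :: DA) (dpEnc (uCapN x.length b l k l) :: LA) := by
  have hd : tabDnewF (boolPair x (boolPair c (tabState x b k l DA LA))) = dpEnc (dRecCap x.length b (l + 1)) := by
    simp only [tabDnewF, tabState, Function.comp_apply, fanoutFn_apply, nthF_zero_boolPair, nthF_succ_boolPair]
    rw [nthLF_nthLF_tableCode x b l hl hl hx, zcapF_dpEnc, if_pos (natAbs_uRecCap_lt _ _ _ _ _),
      show l + 1 = ((⟨l, hl⟩ : Fin n) : ℕ) + 1 from rfl, dRecCap_succ]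
  have hlam : tabLamF (boolPair x (boolPair c (tabState x b k l DA LA))) = dpEnc (uCapN x.length b l k l) := by
    simp only [tabLamF, tabState, Function.comp_apply, fanoutFn_apply, nthF_zero_boolPair, nthF_succ_boolPair]
    rw [nthLF_nthLF_tableCode x b l hk hl hx, zcapF_dpEnc, if_pos (natAbs_uRecCap_lt _ _ _ _ _),
      ← uCapN_eq x.length b l ⟨k, hk⟩ ⟨l, hl⟩]
  have hlev : tabLevelF (boolPair x (boolPair c (tabState x b k l DA LA))) = tableCode x.length b (l + 1) := by
    simp only [tabLevelF, tabState, Function.comp_apply, fanoutFn_apply, nthF_zero_boolPair, nthF_succ_boolPair]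
    exact levelF_apply x hx hl b
  have hsucc : succLLF (boolPair x (boolPair c (tabState x b k l DA LA))) = encodeNat (l + 1) := by
    simp [succLLF, tabState]
  rw [tabBody]
  simp only [fanoutFn_apply, hd, hlam, hlev, hsucc]
  simp [tabState, nthF, sndPow, encList_cons]

/-- **The tables loop from level `l` for `t` rounds** (`l + t ≤ n`). [folklore] -/
theorem loopModel_tabBody (x : List Bool) (b : Fin n → (Fin n → ℤ)) {k : ℕ} (hk : k < n) (hx : n ≤ x.length) :
    ∀ (t l : ℕ) (DA LA : List (List Bool)), l + t ≤ n →
      loopModel tabBody x t (tabState x b k l DA LA) =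
        tabState x b k (l + t)
          (((List.range' (l + 1) t).map fun i => dpEnc (dRecCap x.length b i)).reverse ++ DA)
          (((List.range' l t).map fun i => dpEnc (uCapN x.length b i k i)).reverse ++ LA)
  | 0, l, DA, LA, _ => by simp [loopModel]
  | t + 1, l, DA, LA, h => by
    rw [loopModel, tabBody_apply x _ b hk (by omega) hx, loopModel_tabBody x b hk hx t (l + 1) _ _ (by omega)]
    simp only [List.range'_succ, List.map_cons, List.reverse_cons, List.append_assoc, List.singleton_append]
    congr 1; omega

/-- The initial record of the tables loop on a matrix code. [folklore] -/
theorem tabInit_apply (x : List Bool) (b : Fin n → (Fin n → ℤ)) (k : ℕ) (hx : n ≤ x.length) :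
    tabInit (boolPair x (boolPair (encodeNat n) (boolPair (encodeNat k) (matCode b)))) =
      boolPair x (boolPair (encodeNat n) (tabState x b k 0 [dpEnc 1] [])) := by
  simp only [tabInit, fanoutFn_apply, nthF_zero_boolPair, nthF_succ_boolPair, sndPow_succ_boolPair, sndPow_zero, sndF_boolPair,
    Function.comp_apply, gramF_apply x hx b, tabState]
  rfl

/-- `(range (n+1)).map f` reversed, split at `0`. [folklore] -/
theorem reverse_map_range_succ {α : Type*} (f : ℕ → α) (n : ℕ) :
    ((List.range' 1 n).map f).reverse ++ [f 0] = ((List.range (n + 1)).map f).reverse := by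
  rw [List.range_eq_range', List.range'_succ]
  simp

/-- **Semantics of `tablesF`** (`k < n`, `n + 1 ≤ |x|`): the `d`-list and the `λ`-row of index `k` of the
matrix `b`, saturated at width `|x|`. [cite: Cohen1993, Algorithm 2.6.7] -/
theorem tablesF_apply (x : List Bool) (b : Fin n → (Fin n → ℤ)) {k : ℕ} (hk : k < n) (hx : n + 1 ≤ x.length) :
    tablesF (boolPair x (boolPair (encodeNat n) (boolPair (encodeNat k) (matCode b)))) =
      boolPair (dListCode x.length b) (lamListCode x.length b k) := by
  rw [tablesF, Function.comp_apply, Function.comp_apply, tabInit_apply x b k (by omega), loopX_apply _ _ _ (by omega),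
    loopModel_tabBody x b hk (by omega) n 0 _ _ (by omega), fanoutFn_apply, Nat.zero_add, List.append_nil]
  set DA := ((List.range' 1 n).map fun i => dpEnc (dRecCap x.length b i)).reverse ++ [dpEnc 1] with hDA
  set LA := ((List.range' 0 n).map fun i => dpEnc (uCapN x.length b i k i)).reverse with hLA
  have hDAlen : DA.length = n + 1 := by simp [hDA]
  have hLAlen : LA.length = n := by simp [hLA]
  have hD : tabDListF (boolPair x (boolPair [] (tabState x b k n DA LA))) = dListCode x.length b := by
    have e : tabDListF (boolPair x (boolPair [] (tabState x b k n DA LA))) =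
        takeRevLF (boolPair x (boolPair (encodeNat (n + 1)) (encList DA))) := by
      simp [tabDListF, tabState, nthF, show bitsToNat [true] = 1 from rfl]
    rw [e, takeRevLF_apply x hx, List.take_of_length_le (by omega), hDA, show dpEnc 1 = dpEnc (dRecCap x.length b 0) by rfl,
      reverse_map_range_succ, List.reverse_reverse, dListCode, zlist_eq, List.map_map]
    rfl
  have hL : tabLamListF (boolPair x (boolPair [] (tabState x b k n DA LA))) = lamListCode x.length b k := by
    have e : tabLamListF (boolPair x (boolPair [] (tabState x b k n DA LA))) = takeRevLF (boolPair x (boolPair (encodeNat n) (encList LA))) := by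
      simp [tabLamListF, tabState, nthF, sndPow]
    rw [e, takeRevLF_apply x (by omega), List.take_of_length_le (by omega), hLA, List.reverse_reverse, lamListCode, zlist_eq,
      List.map_map, List.range_eq_range']
    rfl
  rw [hD, hL]

/-! #### The tables are absolutely bounded -/

/-- The output bound of `tablesF`: `16|x|² + 30|x| + 22`. [folklore] -/
def tabOut : Polynomial ℕ := 16 * X ^ 2 + 30 * X + 22

/-- **`tablesF` has absolutely bounded output**: `|tablesF z| ≤ tabOut(|fstF z|)` on every input. [folklore] -/
theorem length_tablesF_le (z : List Bool) : (tablesF z).length ≤ tabOut.eval (fstF z).length := by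
  have hinit : tabInit z = boolPair (fstF z) (boolPair (nthF 1 z) (sndPow 1 (tabInit z))) := by simp [tabInit, sndPow]
  rw [tablesF, Function.comp_apply, Function.comp_apply, fanoutFn_apply, length_boolPair]
  set R := loopX tabBody (tabInit z) with hR
  have hRrec : R = boolPair (fstF z) (boolPair (cntRun (nthF 1 z) (fstF z).length) (loopRun tabBody (fstF z) (nthF 1 z) (fstF z).length (sndPow 1 (tabInit z)))) := by
    rw [hR]; conv_lhs => rw [hinit]; rw [loopX_record]
  set Sf := loopRun tabBody (fstF z) (nthF 1 z) (fstF z).length (sndPow 1 (tabInit z)) with hSf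
  have hpot := potential_loopRun_le (body := tabBody) (x := fstF z) (fun S => (nthF 5 S).length + (sndPow 5 S).length)
    (8 * (fstF z).length + 12) (fun c S hc => potential_tabBody (fstF z) c S hc) (fstF z).length (nthF 1 z) (sndPow 1 (tabInit z))
  have hact := Nat.mul_le_mul_right (8 * (fstF z).length + 12) (activeRounds_le (nthF 1 z) (fstF z).length)
  have h0 : (nthF 5 (sndPow 1 (tabInit z))).length + (sndPow 5 (sndPow 1 (tabInit z))).length = 10 := by
    simp [tabInit, nthF, sndPow, encList_cons, dpEnc, show (1 : ℤ).toNat = 1 from rfl, show (-1 : ℤ).toNat = 0 from rfl]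
    rfl
  rw [h0, ← hSf] at hpot
  have hd : (tabDListF R).length ≤ (nthF 5 Sf).length + 2 * (fstF z).length := by
    have := length_takeRevLF_le (boolPair (nthF 0 R) (boolPair ((addFn ∘ fanoutFn (nthF 2) fun _ => [true]) R) (nthF 7 R)))
    simp only [fstF_boolPair, sndPow_succ_boolPair, sndPow_zero, sndF_boolPair] at this
    rw [tabDListF, Function.comp_apply, fanoutFn_apply, fanoutFn_apply]
    refine this.trans ?_
    rw [hRrec]; simp [nthF]
  have hl : (tabLamListF R).length ≤ (sndPow 5 Sf).length + 2 * (fstF z).length := by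
    have := length_takeRevLF_le (boolPair (nthF 0 R) (boolPair (nthF 2 R) (sndPow 7 R)))
    simp only [fstF_boolPair, sndPow_succ_boolPair, sndPow_zero, sndF_boolPair] at this
    rw [tabLamListF, Function.comp_apply, fanoutFn_apply, fanoutFn_apply]
    refine this.trans ?_
    rw [hRrec]; simp [nthF, sndPow]
  simp only [tabOut, eval_add, eval_mul, eval_pow, eval_ofNat, eval_X]
  nlinarith

/-! ### The size reduction `RED(k, l)` -/

/-- The entry function of the row operation on `⟨x, ⟨q, ⟨a, b⟩⟩⟩`: `zcapF ⟨x, a - q b⟩`.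
[cite: Cohen1993, Algorithm 2.6.7 (Sub-algorithm RED)] -/
def redEntry : List Bool → List Bool :=
  zcapF ∘ fanoutFn (nthF 0) (zsubF ∘ fanoutFn (nthF 2) (zmulF ∘ fanoutFn (nthF 1) (sndPow 2)))

/-- `redEntry ∈ FP`. [folklore] -/
theorem redEntry_mem_FP : redEntry ∈ FP :=
  comp_mem_FP zcapF_mem_FP (fanoutFn_mem_FP (nthF_mem_FP 0) (comp_mem_FP zsubF_mem_FP (fanoutFn_mem_FP (nthF_mem_FP 2)
    (comp_mem_FP zmulF_mem_FP (fanoutFn_mem_FP (nthF_mem_FP 1) (sndPow_mem_FP 2))))))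

/-- `redEntry` saturates. [folklore] -/
theorem length_redEntry_le (x p a c : List Bool) :
    (redEntry (boolPair x (boolPair p (boolPair a c)))).length ≤ 0 * (a.length + c.length) + (2 * X + 2 : Polynomial ℕ).eval x.length := by
  rw [redEntry, Function.comp_apply, fanoutFn_apply]
  refine (length_zcapF_le _).trans ?_
  simp

/-- Semantics of `redEntry` on canonical codes. [folklore] -/
theorem redEntry_apply (x : List Bool) (q a c : ℤ) :
    redEntry (boolPair x (boolPair (dpEnc q) (boolPair (dpEnc a) (dpEnc c)))) = dpEnc (capZ x.length (a - q * c)) := by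
  simp only [redEntry, Function.comp_apply, fanoutFn_apply, nthF_zero_boolPair, nthF_succ_boolPair, sndPow_succ_boolPair,
    sndPow_zero, sndF_boolPair, zmulF_boolPair, ival_dpEnc, zsubF_boolPair]
  rw [zcapF_dpEnc, capZ]

/-- The prepared record of `RED(k,l)` from `⟨x, ⟨nn, ⟨kk, ⟨ll, M⟩⟩⟩⟩`: with `⟨dL, lamL⟩ = tablesF ⟨x, ⟨nn, ⟨kk, M⟩⟩⟩`,
`⟨x, ⟨nn, ⟨kk, ⟨ll, ⟨M, ⟨λ = lamL[l], d = dL[l+1]⟩⟩⟩⟩⟩⟩`. [folklore] -/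
def redPrep : List Bool → List Bool :=
  fanoutFn (nthF 0) (fanoutFn (nthF 1) (fanoutFn (nthF 2) (fanoutFn (nthF 3) (fanoutFn (sndPow 3)
    (fanoutFn
      (nthLF ∘ fanoutFn (nthF 0) (fanoutFn (nthF 3) (sndF ∘ tablesF ∘ fanoutFn (nthF 0) (fanoutFn (nthF 1) (fanoutFn (nthF 2) (sndPow 3))))))
      (nthLF ∘ fanoutFn (nthF 0) (fanoutFn (addFn ∘ fanoutFn (nthF 3) (fun _ => [true]))
        (fstF ∘ tablesF ∘ fanoutFn (nthF 0) (fanoutFn (nthF 1) (fanoutFn (nthF 2) (sndPow 3)))))))))))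

/-- `redPrep ∈ FP`. [folklore] -/
theorem redPrep_mem_FP : redPrep ∈ FP := by
  have hT : (tablesF ∘ fanoutFn (nthF 0) (fanoutFn (nthF 1) (fanoutFn (nthF 2) (sndPow 3)))) ∈ FP :=
    comp_mem_FP tablesF_mem_FP (fanoutFn_mem_FP (nthF_mem_FP 0) (fanoutFn_mem_FP (nthF_mem_FP 1) (fanoutFn_mem_FP (nthF_mem_FP 2) (sndPow_mem_FP 3))))
  exact fanoutFn_mem_FP (nthF_mem_FP 0) (fanoutFn_mem_FP (nthF_mem_FP 1) (fanoutFn_mem_FP (nthF_mem_FP 2) (fanoutFn_mem_FP (nthF_mem_FP 3)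
    (fanoutFn_mem_FP (sndPow_mem_FP 3) (fanoutFn_mem_FP
      (comp_mem_FP nthLF_mem_FP (fanoutFn_mem_FP (nthF_mem_FP 0) (fanoutFn_mem_FP (nthF_mem_FP 3) (comp_mem_FP sndF_mem_FP hT))))
      (comp_mem_FP nthLF_mem_FP (fanoutFn_mem_FP (nthF_mem_FP 0) (fanoutFn_mem_FP (comp_mem_FP addFn_mem_FP (fanoutFn_mem_FP (nthF_mem_FP 3) (const_mem_FP _)))
        (comp_mem_FP fstF_mem_FP hT)))))))))

/-- **Semantics of `redPrep`** (`k < n`, `l < n`, `n + 1 ≤ |x|`). [folklore] -/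
theorem redPrep_apply (x : List Bool) (b : Fin n → (Fin n → ℤ)) {k l : ℕ} (hk : k < n) (hl : l < n) (hx : n + 1 ≤ x.length) :
    redPrep (boolPair x (boolPair (encodeNat n) (boolPair (encodeNat k) (boolPair (encodeNat l) (matCode b))))) =
      boolPair x (boolPair (encodeNat n) (boolPair (encodeNat k) (boolPair (encodeNat l) (boolPair (matCode b)
        (boolPair (dpEnc (uCapN x.length b l k l)) (dpEnc (dRecCap x.length b (l + 1)))))))) := by
  simp only [redPrep, fanoutFn_apply, nthF_zero_boolPair, nthF_succ_boolPair, sndPow_succ_boolPair, sndPow_zero, sndF_boolPair,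
    Function.comp_apply, tablesF_apply x b hk hx, fstF_boolPair, addFn_boolPair, bitsToNat_encodeNat]
  rw [lamListCode, zlist_eq, nthLF_apply x (by omega), lamListCode_getD _ _ _ hl, show bitsToNat [true] = 1 from rfl, dListCode,
    zlist_eq, nthLF_apply x (by omega), dListCode_getD _ _ (by omega)]

/-- The pieces of the prepared record (fields `x:0, nn:1, kk:2, ll:3, M:4, λ:5, d: sndPow 5`) are in place whatever
the input: the matrix field of `redPrep z` is `sndPow 3 z` and the yardstick is `fstF z`. [folklore] -/
theorem redPrep_fields (z : List Bool) : nthF 4 (redPrep z) = sndPow 3 z ∧ nthF 0 (redPrep z) = nthF 0 z ∧ nthF 2 (redPrep z) = nthF 2 z := by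
  simp [redPrep]

/-- The size-reduction test on the prepared record: `[2|λ| ≤ d]`. [cite: Cohen1993, Algorithm 2.6.7 (Sub-algorithm RED)] -/
def redTest : List Bool → List Bool :=
  zleF ∘ fanoutFn (zaddF ∘ fanoutFn (zabsF ∘ nthF 5) (zabsF ∘ nthF 5)) (sndPow 5)

/-- `redTest` is one-bit. [folklore] -/
theorem oneBit_redTest : OneBit redTest := oneBit_zleF.comp _

/-- `redTest ∈ FP`. [folklore] -/
theorem redTest_mem_FP : redTest ∈ FP :=
  comp_mem_FP zleF_mem_FP (fanoutFn_mem_FP (comp_mem_FP zaddF_mem_FP (fanoutFn_mem_FP (comp_mem_FP zabsF_mem_FP (nthF_mem_FP 5)) (comp_mem_FP zabsF_mem_FP (nthF_mem_FP 5))))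
    (sndPow_mem_FP 5))

/-- The multiplier `q = (2λ + d) / (2d)` on the prepared record. [cite: Cohen1993, Algorithm 2.6.7 (Sub-algorithm RED)] -/
def redQ : List Bool → List Bool :=
  zedivF ∘ fanoutFn (zaddF ∘ fanoutFn (zaddF ∘ fanoutFn (nthF 5) (nthF 5)) (sndPow 5)) (zaddF ∘ fanoutFn (sndPow 5) (sndPow 5))

/-- `redQ ∈ FP`. [folklore] -/
theorem redQ_mem_FP : redQ ∈ FP :=
  comp_mem_FP zedivF_mem_FP (fanoutFn_mem_FP (comp_mem_FP zaddF_mem_FP (fanoutFn_mem_FP (comp_mem_FP zaddF_mem_FP (fanoutFn_mem_FP (nthF_mem_FP 5) (nthF_mem_FP 5))) (sndPow_mem_FP 5)))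
    (comp_mem_FP zaddF_mem_FP (fanoutFn_mem_FP (sndPow_mem_FP 5) (sndPow_mem_FP 5))))

/-- The new row `k` on the prepared record: the zip of `redEntry` over `(M[k], M[l])` with parameter `q`.
[cite: Cohen1993, Algorithm 2.6.7 (Sub-algorithm RED)] -/
def redNewRow : List Bool → List Bool :=
  zipLF redEntry ∘ fanoutFn (nthF 0) (fanoutFn (nthF 1) (fanoutFn redQ
    (fanoutFn (nthLF ∘ fanoutFn (nthF 0) (fanoutFn (nthF 2) (nthF 4))) (nthLF ∘ fanoutFn (nthF 0) (fanoutFn (nthF 3) (nthF 4))))))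

/-- `redNewRow ∈ FP`. [folklore] -/
theorem redNewRow_mem_FP : redNewRow ∈ FP :=
  comp_mem_FP (zipLF_mem_FP redEntry_mem_FP (w := 0) (by norm_num) length_redEntry_le)
    (fanoutFn_mem_FP (nthF_mem_FP 0) (fanoutFn_mem_FP (nthF_mem_FP 1) (fanoutFn_mem_FP redQ_mem_FP
      (fanoutFn_mem_FP (comp_mem_FP nthLF_mem_FP (fanoutFn_mem_FP (nthF_mem_FP 0) (fanoutFn_mem_FP (nthF_mem_FP 2) (nthF_mem_FP 4))))
        (comp_mem_FP nthLF_mem_FP (fanoutFn_mem_FP (nthF_mem_FP 0) (fanoutFn_mem_FP (nthF_mem_FP 3) (nthF_mem_FP 4))))))))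

/-- `redNewRow` has absolutely bounded output: `≤ |x|(4|x| + 8)`. [folklore] -/
theorem length_redNewRow_le (r : List Bool) : (redNewRow r).length ≤ (nthF 0 r).length * (4 * (nthF 0 r).length + 8) := by
  rw [redNewRow, Function.comp_apply]
  set w := (fanoutFn (nthF 0) (fanoutFn (nthF 1) (fanoutFn redQ (fanoutFn (nthLF ∘ fanoutFn (nthF 0) (fanoutFn (nthF 2) (nthF 4)))
    (nthLF ∘ fanoutFn (nthF 0) (fanoutFn (nthF 3) (nthF 4))))))) r
  have h := length_zipLF_le (f := redEntry) 0 (P := 2 * X + 2) length_redEntry_le w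
  have e0 : fstF w = nthF 0 r := by simp [w]
  rw [e0] at h
  simp only [zero_mul, zero_add, eval_add, eval_mul, eval_ofNat, eval_X] at h
  nlinarith

/-- **`RED(k,l)` on the prepared record**: keep the matrix if the test holds, else set row `k` to the new row.
[cite: Cohen1993, Algorithm 2.6.7 (Sub-algorithm RED)] -/
def redCore : List Bool → List Bool :=
  iteFn redTest (nthF 4) (setNthLF ∘ fanoutFn (nthF 0) (fanoutFn (nthF 2) (fanoutFn redNewRow (nthF 4))))

/-- `redCore ∈ FP`. [folklore] -/
theorem redCore_mem_FP : redCore ∈ FP :=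
  iteFn_mem_FP redTest_mem_FP (nthF_mem_FP 4) (comp_mem_FP setNthLF_mem_FP (fanoutFn_mem_FP (nthF_mem_FP 0)
    (fanoutFn_mem_FP (nthF_mem_FP 2) (fanoutFn_mem_FP redNewRow_mem_FP (nthF_mem_FP 4)))))

/-- **`RED(k, l)` of the machine** on `⟨x, ⟨nn, ⟨kk, ⟨ll, M⟩⟩⟩⟩`. [cite: Cohen1993, Algorithm 2.6.7 (Sub-algorithm RED)] -/
def redF : List Bool → List Bool := redCore ∘ redPrep

/-- `redF ∈ FP`. [folklore] -/
theorem redF_mem_FP : redF ∈ FP := comp_mem_FP redCore_mem_FP redPrep_mem_FP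

/-- The growth polynomial of `RED`: `2 |x|(4|x|+8) + 4|x| + 2`. [folklore] -/
def redGrowth : Polynomial ℕ := 2 * (X * (4 * X + 8)) + 4 * X + 2

/-- **Growth of `RED`**: `|redF z| ≤ |M| + redGrowth(|x|)` on every input (`M = sndPow 3 z`). [folklore] -/
theorem length_redF_le (z : List Bool) : (redF z).length ≤ (sndPow 3 z).length + redGrowth.eval (nthF 0 z).length := by
  obtain ⟨h4, h0, _⟩ := redPrep_fields z
  rw [redF, Function.comp_apply, redCore, iteFn_of_oneBit oneBit_redTest]
  split_ifs
  · rw [h4]; exact Nat.le_add_right _ _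
  · rw [Function.comp_apply, fanoutFn_apply, fanoutFn_apply, fanoutFn_apply]
    have h := length_setNthLF_le (boolPair (nthF 0 (redPrep z)) (boolPair (nthF 2 (redPrep z)) (boolPair (redNewRow (redPrep z)) (nthF 4 (redPrep z)))))
    simp only [fstF_boolPair, nthF_succ_boolPair, nthF_zero_boolPair, sndPow_succ_boolPair, sndPow_zero, sndF_boolPair] at h
    have hr := length_redNewRow_le (redPrep z)
    rw [h4, h0]
    rw [h4, h0] at h
    rw [h0] at hr
    simp only [redGrowth, eval_add, eval_mul, eval_ofNat, eval_X]
    nlinarith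

/-- Updating one row of a matrix code. [folklore] -/
theorem set_ofFn_rowCode {m : ℕ} (b : Fin n → (Fin m → ℤ)) {k : ℕ} (hk : k < n) (w : Fin m → ℤ) :
    (List.ofFn fun i => rowCode (b i)).set k (rowCode w) = List.ofFn fun i => rowCode (Function.update b ⟨k, hk⟩ w i) := by
  apply List.ext_getElem (by simp)
  intro i h₁ h₂
  simp only [List.length_set, List.length_ofFn] at h₁
  rw [List.getElem_ofFn]
  by_cases hik : k = i
  · subst hik; simp
  · rw [List.getElem_set_of_ne hik, List.getElem_ofFn, Function.update_of_ne]
    exact fun h => hik (congrArg Fin.val h).symm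

/-- **Semantics of `redF`**: `RED(k,l)` of the saturated model, `sizeReduceCap`. (`k, l < n`, `n + 1 ≤ |x|`.)
[cite: Cohen1993, Algorithm 2.6.7 (Sub-algorithm RED)] -/
theorem redF_apply (x : List Bool) (b : Fin n → (Fin n → ℤ)) {k l : ℕ} (hk : k < n) (hl : l < n) (hx : n + 1 ≤ x.length) :
    redF (boolPair x (boolPair (encodeNat n) (boolPair (encodeNat k) (boolPair (encodeNat l) (matCode b))))) =
      matCode (sizeReduceCap x.length b ⟨k, hk⟩ ⟨l, hl⟩) := by
  rw [redF, Function.comp_apply, redPrep_apply x b hk hl hx, uCapN_eq x.length b l ⟨k, hk⟩ ⟨l, hl⟩, redCore]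
  unfold sizeReduceCap
  set u := uRecCap x.length b l ⟨k, hk⟩ ⟨l, hl⟩ with hu
  set d := dRecCap x.length b (l + 1) with hd
  have htest : redTest (boolPair x (boolPair (encodeNat n) (boolPair (encodeNat k) (boolPair (encodeNat l) (boolPair (matCode b)
      (boolPair (dpEnc u) (dpEnc d))))))) = [decide (2 * |u| ≤ d)] := by
    simp only [redTest, Function.comp_apply, fanoutFn_apply, nthF_succ_boolPair, nthF_zero_boolPair, sndPow_succ_boolPair, sndPow_zero,
      sndF_boolPair, zabsF_dpEnc, zaddF_boolPair, ival_dpEnc, zleF_boolPair, two_mul]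
  by_cases hc : 2 * |u| ≤ d
  · rw [iteFn_apply_true (by rw [htest]; simp [hc]), if_pos hc]; simp
  · rw [iteFn_apply_false (by rw [htest]; simp [hc]), if_neg hc]
    simp only [Function.comp_apply, fanoutFn_apply, nthF_zero_boolPair, nthF_succ_boolPair]
    have hq : redQ (boolPair x (boolPair (encodeNat n) (boolPair (encodeNat k) (boolPair (encodeNat l) (boolPair (matCode b)
        (boolPair (dpEnc u) (dpEnc d))))))) = dpEnc ((2 * u + d) / (2 * d)) := by
      simp only [redQ, Function.comp_apply, fanoutFn_apply, nthF_succ_boolPair, nthF_zero_boolPair, sndPow_succ_boolPair, sndPow_zero,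
        sndF_boolPair, zaddF_boolPair, ival_dpEnc, zedivF_dpEnc, two_mul]
    have hrow : redNewRow (boolPair x (boolPair (encodeNat n) (boolPair (encodeNat k) (boolPair (encodeNat l) (boolPair (matCode b)
        (boolPair (dpEnc u) (dpEnc d))))))) = rowCode (capVec x.length (b ⟨k, hk⟩ - ((2 * u + d) / (2 * d)) • b ⟨l, hl⟩)) := by
      simp only [redNewRow, Function.comp_apply, fanoutFn_apply, nthF_zero_boolPair, nthF_succ_boolPair, hq]
      rw [matCode, nthLF_apply x (by omega), getD_ofFn_rowCode b ⟨k, hk⟩, nthLF_apply x (by omega), getD_ofFn_rowCode b ⟨l, hl⟩, rowCode,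
        rowCode, zlist_eq, zlist_eq, zipLF_apply _ _ _ (by omega), List.take_of_length_le (by simp), List.take_of_length_le (by simp),
        List.map_ofFn, List.map_ofFn, zipImages_ofFn, rowCode, zlist_eq, List.map_ofFn]
      refine congrArg encList (congrArg List.ofFn (funext fun t => ?_))
      simp only [Function.comp_apply, capVec, Pi.sub_apply, Pi.smul_apply, smul_eq_mul]
      exact redEntry_apply x _ _ _
    rw [hrow, matCode, setNthLF_apply x (by omega) _ (by simp [hk]), set_ofFn_rowCode b hk, matCode]

/-! ### The descending size-reduction loop `RED(k,k-2), …, RED(k,0)` -/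

/-- The body of the descending loop on `⟨x, ⟨cnt, ⟨nn, ⟨kk, M⟩⟩⟩⟩`: `⟨nn, ⟨kk, RED(k, cnt - 1)(M)⟩⟩`.
[cite: LenstraLenstraLovasz1982, §1 Fig. 1] [cite: Cohen1993, Algorithm 2.6.7] -/
def redLoopBody : List Bool → List Bool :=
  fanoutFn (nthF 2) (fanoutFn (nthF 3) (redF ∘ fanoutFn (nthF 0) (fanoutFn (nthF 2) (fanoutFn (nthF 3) (fanoutFn predCntF (sndPow 3))))))

/-- `redLoopBody ∈ FP`. [folklore] -/
theorem redLoopBody_mem_FP : redLoopBody ∈ FP :=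
  fanoutFn_mem_FP (nthF_mem_FP 2) (fanoutFn_mem_FP (nthF_mem_FP 3) (comp_mem_FP redF_mem_FP (fanoutFn_mem_FP (nthF_mem_FP 0)
    (fanoutFn_mem_FP (nthF_mem_FP 2) (fanoutFn_mem_FP (nthF_mem_FP 3) (fanoutFn_mem_FP predCntF_mem_FP (sndPow_mem_FP 3)))))))

/-- Growth of the descending-loop body: `≤ |state| + redGrowth(|x|) + 4`. [folklore] -/
theorem length_redLoopBody_le (z : List Bool) : (redLoopBody z).length ≤ (sndPow 1 z).length + (redGrowth + 4).eval (fstF z).length := by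
  have c1 := length_nthF_succ_add_sndPow_succ_le 1 z
  have c2 := length_nthF_succ_add_sndPow_succ_le 2 z
  have hr := length_redF_le (boolPair (fstF z) (boolPair (nthF 2 z) (boolPair (nthF 3 z) (boolPair (predCntF z) (sndPow 3 z)))))
  simp only [sndPow_succ_boolPair, sndPow_zero, sndF_boolPair, nthF_zero_boolPair, Nat.reduceAdd] at hr c1 c2
  simp only [redLoopBody, fanoutFn_apply, length_boolPair, Function.comp_apply, eval_add, eval_ofNat, nthF_zero]
  omega

/-- The potential of the descending loop: the matrix (`sndPow 1` of the state) grows by `redGrowth(|x|)` per round.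
[folklore] -/
theorem potential_redLoopBody (x c S : List Bool) (_hc : c ≠ []) :
    (sndPow 1 (redLoopBody (boolPair x (boolPair c S)))).length ≤ (sndPow 1 S).length + redGrowth.eval x.length := by
  have hr := length_redF_le (boolPair x (boolPair (fstF S) (boolPair (nthF 1 S) (boolPair (predCntF (boolPair x (boolPair c S))) (sndPow 1 S)))))
  simp only [sndPow_succ_boolPair, sndPow_zero, sndF_boolPair, nthF_zero_boolPair] at hr
  have e : sndPow 1 (redLoopBody (boolPair x (boolPair c S))) =
      redF (boolPair x (boolPair (fstF S) (boolPair (nthF 1 S) (boolPair (predCntF (boolPair x (boolPair c S))) (sndPow 1 S))))) := by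
    simp [redLoopBody, nthF, sndPow]
  rw [e]; exact hr

/-- The initial record of the descending loop from `⟨x, ⟨nn, ⟨kk, M⟩⟩⟩`: counter `bin (k - 1)`, state
`⟨nn, ⟨kk, M⟩⟩`. [folklore] -/
def redLoopInit : List Bool → List Bool :=
  fanoutFn (nthF 0) (fanoutFn (subFn ∘ fanoutFn (nthF 2) (fun _ => [true])) sndF)

/-- `redLoopInit ∈ FP`. [folklore] -/
theorem redLoopInit_mem_FP : redLoopInit ∈ FP :=
  fanoutFn_mem_FP (nthF_mem_FP 0) (fanoutFn_mem_FP (comp_mem_FP subFn_mem_FP (fanoutFn_mem_FP (nthF_mem_FP 2) (const_mem_FP _))) sndF_mem_FP)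

/-- **The descending loop** `redLoopF ⟨x, ⟨nn, ⟨kk, M⟩⟩⟩`: `RED(k,k-2), …, RED(k,0)` applied to `M`
(`sizeReduceFromCap`). [cite: LenstraLenstraLovasz1982, §1 Fig. 1] [cite: Cohen1993, Algorithm 2.6.7] -/
def redLoopF : List Bool → List Bool := sndPow 3 ∘ loopX redLoopBody ∘ redLoopInit

/-- `redLoopF ∈ FP`. [folklore] -/
theorem redLoopF_mem_FP : redLoopF ∈ FP :=
  comp_mem_FP (sndPow_mem_FP 3) (comp_mem_FP (loopX_mem_FP redLoopBody_mem_FP length_redLoopBody_le) redLoopInit_mem_FP)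

/-- The model of the descending loop: `a` rounds perform `sizeReduceFromCap … a`. [folklore] -/
theorem loopModel_redLoopBody (x : List Bool) {k : ℕ} (hk : k < n) (hx : n + 1 ≤ x.length) :
    ∀ (a : ℕ) (ha : a ≤ n) (_ : a ≤ k) (b : Fin n → (Fin n → ℤ)),
      loopModel redLoopBody x a (boolPair (encodeNat n) (boolPair (encodeNat k) (matCode b))) =
        boolPair (encodeNat n) (boolPair (encodeNat k) (matCode (sizeReduceFromCap x.length ⟨k, hk⟩ a ha b)))
  | 0, _, _, b => by simp [loopModel, sizeReduceFromCap]
  | a + 1, ha, hak, b => by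
    rw [loopModel]
    have e : redLoopBody (boolPair x (boolPair (encodeNat (a + 1)) (boolPair (encodeNat n) (boolPair (encodeNat k) (matCode b))))) =
        boolPair (encodeNat n) (boolPair (encodeNat k) (matCode (sizeReduceCap x.length b ⟨k, hk⟩ ⟨a, ha⟩))) := by
      simp only [redLoopBody, fanoutFn_apply, nthF_succ_boolPair, nthF_zero_boolPair, sndPow_succ_boolPair, sndPow_zero, sndF_boolPair,
        Function.comp_apply, predCntF_apply, bitsToNat_encodeNat, Nat.add_sub_cancel]
      rw [redF_apply x b hk ha hx]
    rw [e, loopModel_redLoopBody x hk hx a (Nat.le_of_succ_le ha) (Nat.le_of_succ_le hak)]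
    rfl

/-- **Semantics of `redLoopF`** (`0 < k < n`, `n + 1 ≤ |x|`). [cite: Cohen1993, Algorithm 2.6.7] -/
theorem redLoopF_apply (x : List Bool) (b : Fin n → (Fin n → ℤ)) {k : ℕ} (hk0 : 0 < k) (hk : k < n) (hx : n + 1 ≤ x.length) :
    redLoopF (boolPair x (boolPair (encodeNat n) (boolPair (encodeNat k) (matCode b)))) =
      matCode (sizeReduceFromCap x.length ⟨k, hk⟩ (k - 1) (by omega) b) := by
  have e : redLoopInit (boolPair x (boolPair (encodeNat n) (boolPair (encodeNat k) (matCode b)))) =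
      boolPair x (boolPair (encodeNat (k - 1)) (boolPair (encodeNat n) (boolPair (encodeNat k) (matCode b)))) := by
    simp [redLoopInit, show bitsToNat [true] = 1 from rfl]
  rw [redLoopF, Function.comp_apply, Function.comp_apply, e, loopX_apply _ _ _ (by omega),
    loopModel_redLoopBody x hk hx (k - 1) (by omega) (by omega) b]
  simp

/-- **Growth of the descending loop**: `|redLoopF z| ≤ |M| + |x| · redGrowth(|x|)` (`M = sndPow 2 z`). [folklore] -/
theorem length_redLoopF_le (z : List Bool) :
    (redLoopF z).length ≤ (sndPow 2 z).length + (fstF z).length * redGrowth.eval (fstF z).length := by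
  have e : redLoopInit z = boolPair (fstF z) (boolPair ((subFn ∘ fanoutFn (nthF 2) fun _ => [true]) z) (sndF z)) := by simp [redLoopInit]
  rw [redLoopF, Function.comp_apply, Function.comp_apply, e, loopX_record, sndPow_succ_boolPair, sndPow_succ_boolPair]
  have hpot := potential_loopRun_le (body := redLoopBody) (x := fstF z) (fun S => (sndPow 1 S).length) (redGrowth.eval (fstF z).length)
    (fun c S hc => potential_redLoopBody (fstF z) c S hc) (fstF z).length ((subFn ∘ fanoutFn (nthF 2) fun _ => [true]) z) (sndF z)
  have hact := Nat.mul_le_mul_right (redGrowth.eval (fstF z).length) (activeRounds_le ((subFn ∘ fanoutFn (nthF 2) fun _ => [true]) z) (fstF z).length)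
  have e2 : sndPow 1 (sndF z) = sndPow 2 z := rfl
  rw [e2] at hpot
  exact hpot.trans (Nat.add_le_add_left hact _)

/-! ### The pass: `RED(k,k-1)`, the Lovász test, and the branch -/

/-- `bin (⟦kk⟧ - 1)` of field `2` (the index `j = k - 1`). [folklore] -/
def predKF : List Bool → List Bool := subFn ∘ fanoutFn (nthF 2) (fun _ => [true])

/-- `bin (⟦kk⟧ + 1)` of field `2`. [folklore] -/
def succKF : List Bool → List Bool := addFn ∘ fanoutFn (nthF 2) (fun _ => [true])

/-- `predKF` on a record. [folklore] -/
theorem predKF_eq (z : List Bool) : predKF z = encodeNat (bitsToNat (nthF 2 z) - 1) := by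
  simp [predKF, show bitsToNat [true] = 1 from rfl]

/-- `succKF` on a record. [folklore] -/
theorem succKF_eq (z : List Bool) : succKF z = encodeNat (bitsToNat (nthF 2 z) + 1) := by
  simp [succKF, show bitsToNat [true] = 1 from rfl]

/-- `|predKF z| ≤ |nthF 2 z|`. [folklore] -/
theorem length_predKF_le (z : List Bool) : (predKF z).length ≤ (nthF 2 z).length := by
  rw [predKF_eq]; exact (length_encodeNat_mono (Nat.sub_le _ _)).trans (length_encodeNat_bitsToNat_le _)

/-- `|succKF z| ≤ |nthF 2 z| + 2`. [folklore] -/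
theorem length_succKF_le (z : List Bool) : (succKF z).length ≤ (nthF 2 z).length + 2 := by
  rw [succKF_eq]
  refine (_root_.Literature.Computability.Complexity.length_encodeNat_add_le _ _).trans ?_
  have h1 := length_encodeNat_bitsToNat_le (nthF 2 z)
  have h2 : (encodeNat 1).length = 1 := by decide
  rw [h2]; omega

/-- The first prepared record of the pass from `⟨x, ⟨nn, ⟨kk, M⟩⟩⟩`:
`⟨x, ⟨nn, ⟨kk, ⟨jj, ⟨M, b₁⟩⟩⟩⟩⟩` with `jj = bin (k-1)` and `b₁ = RED(k,k-1)(M)`. [folklore] -/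
def stepPrep : List Bool → List Bool :=
  fanoutFn (nthF 0) (fanoutFn (nthF 1) (fanoutFn (nthF 2) (fanoutFn predKF (fanoutFn (sndPow 2)
    (redF ∘ fanoutFn (nthF 0) (fanoutFn (nthF 1) (fanoutFn (nthF 2) (fanoutFn predKF (sndPow 2)))))))))

/-- The second prepared record: append the tables of `b₁`, `⟨x, ⟨nn, ⟨kk, ⟨jj, ⟨M, ⟨b₁, tabs⟩⟩⟩⟩⟩⟩`. [folklore] -/
def stepPrep2 : List Bool → List Bool :=
  fanoutFn (nthF 0) (fanoutFn (nthF 1) (fanoutFn (nthF 2) (fanoutFn (nthF 3) (fanoutFn (nthF 4) (fanoutFn (sndPow 4)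
    (tablesF ∘ fanoutFn (nthF 0) (fanoutFn (nthF 1) (fanoutFn (nthF 2) (sndPow 4)))))))))

/-- `stepPrep ∈ FP`. [folklore] -/
theorem stepPrep_mem_FP : stepPrep ∈ FP := by
  have hP : predKF ∈ FP := comp_mem_FP subFn_mem_FP (fanoutFn_mem_FP (nthF_mem_FP 2) (const_mem_FP _))
  exact fanoutFn_mem_FP (nthF_mem_FP 0) (fanoutFn_mem_FP (nthF_mem_FP 1) (fanoutFn_mem_FP (nthF_mem_FP 2) (fanoutFn_mem_FP hP
    (fanoutFn_mem_FP (sndPow_mem_FP 2) (comp_mem_FP redF_mem_FP (fanoutFn_mem_FP (nthF_mem_FP 0) (fanoutFn_mem_FP (nthF_mem_FP 1)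
      (fanoutFn_mem_FP (nthF_mem_FP 2) (fanoutFn_mem_FP hP (sndPow_mem_FP 2))))))))))

/-- `stepPrep2 ∈ FP`. [folklore] -/
theorem stepPrep2_mem_FP : stepPrep2 ∈ FP :=
  fanoutFn_mem_FP (nthF_mem_FP 0) (fanoutFn_mem_FP (nthF_mem_FP 1) (fanoutFn_mem_FP (nthF_mem_FP 2) (fanoutFn_mem_FP (nthF_mem_FP 3)
    (fanoutFn_mem_FP (nthF_mem_FP 4) (fanoutFn_mem_FP (sndPow_mem_FP 4) (comp_mem_FP tablesF_mem_FP (fanoutFn_mem_FP (nthF_mem_FP 0)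
      (fanoutFn_mem_FP (nthF_mem_FP 1) (fanoutFn_mem_FP (nthF_mem_FP 2) (sndPow_mem_FP 4))))))))))

/-- `dₖ` on the second prepared record (fields `x:0, nn:1, kk:2, jj:3, M:4, b₁:5, tabs: sndPow 5`). [folklore] -/
def dkF : List Bool → List Bool := nthLF ∘ fanoutFn (nthF 0) (fanoutFn (nthF 2) (fstF ∘ sndPow 5))
/-- `dₖ₊₁`. [folklore] -/
def dk1F : List Bool → List Bool := nthLF ∘ fanoutFn (nthF 0) (fanoutFn succKF (fstF ∘ sndPow 5))
/-- `dₖ₋₁`. [folklore] -/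
def dkmF : List Bool → List Bool := nthLF ∘ fanoutFn (nthF 0) (fanoutFn (nthF 3) (fstF ∘ sndPow 5))
/-- `λₖ,ₖ₋₁`. [folklore] -/
def lamF : List Bool → List Bool := nthLF ∘ fanoutFn (nthF 0) (fanoutFn (nthF 3) (sndF ∘ sndPow 5))

/-- **The integral Lovász test** `[3 dₖ² ≤ 4 (dₖ₊₁ dₖ₋₁ + λ²)]` on the second prepared record.
[cite: Cohen1993, Algorithm 2.6.7 (Step 3, integral Lovász condition)] -/
def lovTest : List Bool → List Bool :=
  zleF ∘ fanoutFn (zmulF ∘ fanoutFn (fun _ => dpEnc 3) (zmulF ∘ fanoutFn dkF dkF))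
    (zmulF ∘ fanoutFn (fun _ => dpEnc 4) (zaddF ∘ fanoutFn (zmulF ∘ fanoutFn dk1F dkmF) (zmulF ∘ fanoutFn lamF lamF)))

/-- `lovTest` is one-bit. [folklore] -/
theorem oneBit_lovTest : OneBit lovTest := oneBit_zleF.comp _

/-- `lovTest ∈ FP`. [folklore] -/
theorem lovTest_mem_FP : lovTest ∈ FP := by
  have hdk : dkF ∈ FP := comp_mem_FP nthLF_mem_FP (fanoutFn_mem_FP (nthF_mem_FP 0) (fanoutFn_mem_FP (nthF_mem_FP 2) (comp_mem_FP fstF_mem_FP (sndPow_mem_FP 5))))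
  have hdk1 : dk1F ∈ FP := comp_mem_FP nthLF_mem_FP (fanoutFn_mem_FP (nthF_mem_FP 0) (fanoutFn_mem_FP
    (comp_mem_FP addFn_mem_FP (fanoutFn_mem_FP (nthF_mem_FP 2) (const_mem_FP _))) (comp_mem_FP fstF_mem_FP (sndPow_mem_FP 5))))
  have hdkm : dkmF ∈ FP := comp_mem_FP nthLF_mem_FP (fanoutFn_mem_FP (nthF_mem_FP 0) (fanoutFn_mem_FP (nthF_mem_FP 3) (comp_mem_FP fstF_mem_FP (sndPow_mem_FP 5))))
  have hlam : lamF ∈ FP := comp_mem_FP nthLF_mem_FP (fanoutFn_mem_FP (nthF_mem_FP 0) (fanoutFn_mem_FP (nthF_mem_FP 3) (comp_mem_FP sndF_mem_FP (sndPow_mem_FP 5))))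
  exact comp_mem_FP zleF_mem_FP (fanoutFn_mem_FP (comp_mem_FP zmulF_mem_FP (fanoutFn_mem_FP (const_mem_FP _) (comp_mem_FP zmulF_mem_FP (fanoutFn_mem_FP hdk hdk))))
    (comp_mem_FP zmulF_mem_FP (fanoutFn_mem_FP (const_mem_FP _) (comp_mem_FP zaddF_mem_FP (fanoutFn_mem_FP (comp_mem_FP zmulF_mem_FP (fanoutFn_mem_FP hdk1 hdkm))
      (comp_mem_FP zmulF_mem_FP (fanoutFn_mem_FP hlam hlam)))))))

/-- The branch after a passed Lovász test: `⟨bin (k+1), redLoop(b₁)⟩`. [cite: LenstraLenstraLovasz1982, §1 Fig. 1] -/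
def thenBranch : List Bool → List Bool :=
  fanoutFn succKF (redLoopF ∘ fanoutFn (nthF 0) (fanoutFn (nthF 1) (fanoutFn (nthF 2) (nthF 5))))

/-- The branch after a failed Lovász test: `⟨bin (max 1 (k-1)), b₁ with rows k-1, k exchanged⟩`.
[cite: LenstraLenstraLovasz1982, §1 Fig. 1] -/
def elseBranch : List Bool → List Bool :=
  fanoutFn (iteFn (isNilFn ∘ nthF 3) (fun _ => encodeNat 1) (nthF 3)) (swapAdjLF ∘ fanoutFn (nthF 0) (fanoutFn (nthF 3) (nthF 5)))

/-- The pass on a running state (`0 < k < n`). [cite: LenstraLenstraLovasz1982, §1 Fig. 1] -/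
def runningF : List Bool → List Bool := iteFn lovTest thenBranch elseBranch

/-- **The saturated LLL pass on the second prepared record**: running states take the branch, the junk
state `k = 0 < n` becomes `k = 1`, halted states are fixed. [cite: LenstraLenstraLovasz1982, §1 Fig. 1] -/
def capStepCore : List Bool → List Bool :=
  iteFn (ltFn ∘ fanoutFn (fun _ => []) (nthF 2))
    (iteFn (ltFn ∘ fanoutFn (nthF 2) (nthF 1)) runningF (fanoutFn (nthF 2) (nthF 4)))
    (iteFn (ltFn ∘ fanoutFn (nthF 2) (nthF 1)) (fanoutFn (fun _ => encodeNat 1) (nthF 4)) (fanoutFn (nthF 2) (nthF 4)))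

/-- **The saturated LLL pass of the machine**: `capStepF ⟨x, ⟨nn, ⟨kk, M⟩⟩⟩ = ⟨kk', M'⟩`.
[cite: LenstraLenstraLovasz1982, §1 Fig. 1] [cite: Cohen1993, Algorithm 2.6.7] -/
def capStepF : List Bool → List Bool := capStepCore ∘ stepPrep2 ∘ stepPrep

/-- `capStepF ∈ FP`. [folklore] -/
theorem capStepF_mem_FP : capStepF ∈ FP := by
  have hS : succKF ∈ FP := comp_mem_FP addFn_mem_FP (fanoutFn_mem_FP (nthF_mem_FP 2) (const_mem_FP _))
  have hthen : thenBranch ∈ FP := fanoutFn_mem_FP hS (comp_mem_FP redLoopF_mem_FP (fanoutFn_mem_FP (nthF_mem_FP 0)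
    (fanoutFn_mem_FP (nthF_mem_FP 1) (fanoutFn_mem_FP (nthF_mem_FP 2) (nthF_mem_FP 5)))))
  have helse : elseBranch ∈ FP := fanoutFn_mem_FP (iteFn_mem_FP (comp_mem_FP isNilFn_mem_FP (nthF_mem_FP 3)) (const_mem_FP _) (nthF_mem_FP 3))
    (comp_mem_FP swapAdjLF_mem_FP (fanoutFn_mem_FP (nthF_mem_FP 0) (fanoutFn_mem_FP (nthF_mem_FP 3) (nthF_mem_FP 5))))
  have hrun : runningF ∈ FP := iteFn_mem_FP lovTest_mem_FP hthen helse
  have hc2 : (ltFn ∘ fanoutFn (nthF 2) (nthF 1)) ∈ FP := comp_mem_FP ltFn_mem_FP (fanoutFn_mem_FP (nthF_mem_FP 2) (nthF_mem_FP 1))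
  have hcore : capStepCore ∈ FP :=
    iteFn_mem_FP (comp_mem_FP ltFn_mem_FP (fanoutFn_mem_FP (const_mem_FP _) (nthF_mem_FP 2)))
      (iteFn_mem_FP hc2 hrun (fanoutFn_mem_FP (nthF_mem_FP 2) (nthF_mem_FP 4)))
      (iteFn_mem_FP hc2 (fanoutFn_mem_FP (const_mem_FP _) (nthF_mem_FP 4)) (fanoutFn_mem_FP (nthF_mem_FP 2) (nthF_mem_FP 4)))
  exact comp_mem_FP hcore (comp_mem_FP stepPrep2_mem_FP stepPrep_mem_FP)

/-! #### The fields of the prepared records -/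

/-- The fields of the pass's prepared record on every input: yardstick, `kk`, `jj`, the matrix, and `b₁`. [folklore] -/
theorem stepPrep2_fields (z : List Bool) :
    nthF 0 (stepPrep2 (stepPrep z)) = fstF z ∧ nthF 1 (stepPrep2 (stepPrep z)) = nthF 1 z ∧
    nthF 2 (stepPrep2 (stepPrep z)) = nthF 2 z ∧ nthF 3 (stepPrep2 (stepPrep z)) = predKF z ∧
    nthF 4 (stepPrep2 (stepPrep z)) = sndPow 2 z ∧
    nthF 5 (stepPrep2 (stepPrep z)) = redF (boolPair (fstF z) (boolPair (nthF 1 z) (boolPair (nthF 2 z) (boolPair (predKF z) (sndPow 2 z))))) ∧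
    sndPow 5 (stepPrep2 (stepPrep z)) = tablesF (boolPair (fstF z) (boolPair (nthF 1 z) (boolPair (nthF 2 z)
      (redF (boolPair (fstF z) (boolPair (nthF 1 z) (boolPair (nthF 2 z) (boolPair (predKF z) (sndPow 2 z))))))))) := by
  simp [stepPrep2, stepPrep, nthF, sndPow, predKF]

/-- Exchanging two adjacent entries of an `ofFn` list. [folklore] -/
theorem ofFn_comp_swap_adj {α : Type*} (f : Fin n → α) (j : ℕ) (hj : j + 1 < n) :
    List.ofFn (fun i => f (Equiv.swap ⟨j, by omega⟩ ⟨j + 1, hj⟩ i)) =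
      (List.ofFn f).take j ++ f ⟨j + 1, hj⟩ :: f ⟨j, by omega⟩ :: (List.ofFn f).drop (j + 2) := by
  apply List.ext_getElem?
  intro i
  rw [List.getElem?_ofFn]
  have hlt : (List.take j (List.ofFn f)).length = j := by simp; omega
  rcases Nat.lt_or_ge i j with hij | hji
  · rw [List.getElem?_append_left (by omega), List.getElem?_take_of_lt hij, List.getElem?_ofFn, dif_pos (by omega), dif_pos (by omega),
      Equiv.swap_apply_of_ne_of_ne (by intro h; have := congrArg Fin.val h; simp at this; omega)
        (by intro h; have := congrArg Fin.val h; simp at this; omega)]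
  · rw [List.getElem?_append_right (by omega), hlt]
    rcases Nat.lt_trichotomy i (j + 1) with h1 | rfl | h1
    · have hi : i = j := by omega
      subst hi
      rw [Nat.sub_self, List.getElem?_cons_zero, dif_pos (by omega)]
      congr 1; exact congrArg f (Equiv.swap_apply_left _ _)
    · rw [show j + 1 - j = 1 by omega, List.getElem?_cons_succ, List.getElem?_cons_zero, dif_pos hj]
      congr 1; exact congrArg f (Equiv.swap_apply_right _ _)
    · obtain ⟨d, rfl⟩ : ∃ d, i = j + 2 + d := ⟨i - (j + 2), by omega⟩
      rw [show j + 2 + d - j = d + 1 + 1 by omega, List.getElem?_cons_succ, List.getElem?_cons_succ, List.getElem?_drop,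
        List.getElem?_ofFn]
      by_cases hd : j + 2 + d < n
      · rw [dif_pos hd, dif_pos (by omega)]
        congr 1
        rw [Equiv.swap_apply_of_ne_of_ne (by intro h; have := congrArg Fin.val h; simp at this; omega)
          (by intro h; have := congrArg Fin.val h; simp at this; omega)]
      · rw [dif_neg hd, dif_neg (by omega)]

/-- **Semantics of `capStepF`**: the saturated LLL pass `capStep |x|` of `LLLCapModel.lean`, for every integer
matrix and index (`n + 1 ≤ |x|`). [cite: LenstraLenstraLovasz1982, §1 Fig. 1] [cite: Cohen1993, Algorithm 2.6.7] -/
theorem capStepF_apply (x : List Bool) (b : Fin n → (Fin n → ℤ)) (k : ℕ) (hx : n + 1 ≤ x.length) :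
    capStepF (boolPair x (boolPair (encodeNat n) (boolPair (encodeNat k) (matCode b)))) =
      boolPair (encodeNat (capStep x.length ⟨b, k⟩).k) (matCode (capStep x.length ⟨b, k⟩).b) := by
  obtain ⟨f0, f1, f2, f3, f4, f5, f6⟩ := stepPrep2_fields (boolPair x (boolPair (encodeNat n) (boolPair (encodeNat k) (matCode b))))
  simp only [fstF_boolPair, nthF_succ_boolPair, nthF_zero_boolPair, sndPow_succ_boolPair, sndPow_zero, sndF_boolPair, predKF_eq,
    bitsToNat_encodeNat] at f0 f1 f2 f3 f4 f5 f6
  set r := stepPrep2 (stepPrep (boolPair x (boolPair (encodeNat n) (boolPair (encodeNat k) (matCode b))))) with hr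
  rw [capStepF, Function.comp_apply, Function.comp_apply, ← hr, capStepCore]
  have hc1 : (ltFn ∘ fanoutFn (fun _ => []) (nthF 2)) r = [decide (0 < k)] := by simp [f2]
  have hc2 : (ltFn ∘ fanoutFn (nthF 2) (nthF 1)) r = [decide (k < n)] := by simp [f2, f1]
  unfold capStep
  by_cases hk : 0 < k ∧ k < n
  · rw [iteFn_apply_true (by rw [hc1]; simp [hk.1]), iteFn_apply_true (by rw [hc2]; simp [hk.2]), dif_pos hk, runningF]
    dsimp only
    have hkn : k < n := hk.2
    have hjn : k - 1 < n := by omega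
    -- the first size reduction and the tables of `b₁`
    have hb₁ : nthF 5 r = matCode (sizeReduceCap x.length b ⟨k, hkn⟩ ⟨k - 1, hjn⟩) := by rw [f5, redF_apply x b hkn hjn hx]
    set b₁ := sizeReduceCap x.length b ⟨k, hkn⟩ ⟨k - 1, hjn⟩ with hb₁def
    have htabs : sndPow 5 r = boolPair (dListCode x.length b₁) (lamListCode x.length b₁ k) := by
      rw [f6, ← f5, hb₁, tablesF_apply x b₁ hkn hx]
    have hdk : dkF r = dpEnc (dRecCap x.length b₁ k) := by
      simp only [dkF, Function.comp_apply, fanoutFn_apply, f0, f2, htabs, fstF_boolPair, dListCode, zlist_eq]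
      rw [nthLF_apply x (by omega), dListCode_getD _ _ (by omega)]
    have hdk1 : dk1F r = dpEnc (dRecCap x.length b₁ (k + 1)) := by
      simp only [dk1F, Function.comp_apply, fanoutFn_apply, f0, succKF_eq, f2, bitsToNat_encodeNat, htabs, fstF_boolPair, dListCode, zlist_eq]
      rw [nthLF_apply x (by omega), dListCode_getD _ _ (by omega)]
    have hdkm : dkmF r = dpEnc (dRecCap x.length b₁ (k - 1)) := by
      simp only [dkmF, Function.comp_apply, fanoutFn_apply, f0, f3, htabs, fstF_boolPair, dListCode, zlist_eq]
      rw [nthLF_apply x (by omega), dListCode_getD _ _ (by omega)]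
    have hlam : lamF r = dpEnc (uRecCap x.length b₁ (k - 1) ⟨k, hkn⟩ ⟨k - 1, hjn⟩) := by
      simp only [lamF, Function.comp_apply, fanoutFn_apply, f0, f3, htabs, sndF_boolPair, lamListCode, zlist_eq]
      rw [nthLF_apply x (by omega), lamListCode_getD _ _ _ hjn]
      exact congrArg dpEnc (uCapN_eq x.length b₁ (k - 1) ⟨k, hkn⟩ ⟨k - 1, hjn⟩)
    have hlov : lovTest r = [decide (3 * dRecCap x.length b₁ k ^ 2 ≤
        4 * (dRecCap x.length b₁ (k + 1) * dRecCap x.length b₁ (k - 1) + uRecCap x.length b₁ (k - 1) ⟨k, hkn⟩ ⟨k - 1, hjn⟩ ^ 2))] := by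
      simp only [lovTest, Function.comp_apply, fanoutFn_apply, hdk, hdk1, hdkm, hlam, zmulF_boolPair, zaddF_boolPair, ival_dpEnc,
        zleF_boolPair, sq]
    by_cases ht : 3 * dRecCap x.length b₁ k ^ 2 ≤
        4 * (dRecCap x.length b₁ (k + 1) * dRecCap x.length b₁ (k - 1) + uRecCap x.length b₁ (k - 1) ⟨k, hkn⟩ ⟨k - 1, hjn⟩ ^ 2)
    · rw [iteFn_apply_true (by rw [hlov]; simp [ht]), if_pos ht, thenBranch]
      simp only [fanoutFn_apply, succKF_eq, f2, bitsToNat_encodeNat, Function.comp_apply, f0, f1, hb₁]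
      rw [redLoopF_apply x b₁ hk.1 hkn hx]
    · rw [iteFn_apply_false (by rw [hlov]; simp [ht]), if_neg ht, elseBranch]
      simp only [fanoutFn_apply, Function.comp_apply, f0, f3, hb₁]
      have hK : iteFn (isNilFn ∘ nthF 3) (fun _ => encodeNat 1) (nthF 3) r = encodeNat (max 1 (k - 1)) := by
        rw [iteFn_of_oneBit (oneBit_isNilFn.comp _)]
        simp only [Function.comp_apply, f3, isNilFn]
        by_cases h1 : k - 1 = 0
        · rw [h1, show encodeNat 0 = [] from rfl]; simp
        · have : encodeNat (k - 1) ≠ [] := fun h => h1 ((Literature.Computability.Complexity.Brick.encodeNat_eq_nil_iff _).1 h)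
          simp [this, show max 1 (k - 1) = k - 1 by omega]
      have hM : swapAdjLF (boolPair x (boolPair (encodeNat (k - 1)) (matCode b₁))) = matCode (b₁ ∘ ⇑(Equiv.swap ⟨k - 1, hjn⟩ ⟨k, hkn⟩)) := by
        rw [matCode, swapAdjLF_apply x (by omega) (L := List.ofFn fun i => rowCode (b₁ i)) (by simp; omega), matCode]
        have := ofFn_comp_swap_adj (fun i => rowCode (b₁ i)) (k - 1) (by omega)
        have ek' : ∀ h : k - 1 + 1 < n, b₁ ⟨k - 1 + 1, h⟩ = b₁ ⟨k, hkn⟩ := fun h => congrArg b₁ (Fin.ext (by simp; omega))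
        simp only [show k - 1 + 2 = k + 1 by omega, List.getElem_ofFn, ek'] at this ⊢
        rw [← this]
        have ek : (⟨k - 1 + 1, by omega⟩ : Fin n) = ⟨k, hkn⟩ := Fin.ext (by simp; omega)
        rw [ek]
        rfl
      rw [hK, hM]
  · rw [iteFn_of_oneBit (oneBit_ltFn.comp _), hc1, dif_neg hk]
    by_cases hkn : k < n
    · have hk0 : ¬ 0 < k := fun h => hk ⟨h, hkn⟩
      rw [if_neg (by simp [hk0]), iteFn_apply_true (by rw [hc2]; simp [hkn]), if_pos hkn]
      simp [f4]
    · by_cases hk0 : 0 < k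
      · rw [if_pos (by simp [hk0]), iteFn_apply_false (by rw [hc2]; simp [hkn]), if_neg hkn]; simp [f2, f4]
      · rw [if_neg (by simp [hk0]), iteFn_apply_false (by rw [hc2]; simp [hkn]), if_neg hkn]; simp [f2, f4]

/-- The growth polynomial of the pass: `(|x|+1) redGrowth + 4|x| + 10`. [folklore] -/
def stepGrowth : Polynomial ℕ := (X + 1) * redGrowth + 4 * X + 10

/-- **Growth of the pass**: `|capStepF z| ≤ |⟨kk, M⟩| + stepGrowth(|x|)` on every input
(`⟨kk, M⟩ = sndPow 1 z`). [folklore] -/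
theorem length_capStepF_le (z : List Bool) : (capStepF z).length ≤ (sndPow 1 z).length + stepGrowth.eval (fstF z).length := by
  obtain ⟨f0, f1, f2, f3, f4, f5, f6⟩ := stepPrep2_fields z
  set r := stepPrep2 (stepPrep z) with hr
  have c1 := length_nthF_succ_add_sndPow_succ_le 1 z
  simp only [Nat.reduceAdd] at c1
  have hjj : (predKF z).length ≤ (nthF 2 z).length := length_predKF_le z
  have hb₁ : (nthF 5 r).length ≤ (sndPow 2 z).length + redGrowth.eval (fstF z).length := by
    rw [f5]
    have := length_redF_le (boolPair (fstF z) (boolPair (nthF 1 z) (boolPair (nthF 2 z) (boolPair (predKF z) (sndPow 2 z)))))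
    simpa using this
  have hthen : (thenBranch r).length ≤ 2 * (nthF 2 z).length + (sndPow 2 z).length +
      (((fstF z).length + 1) * redGrowth.eval (fstF z).length + 6) := by
    rw [thenBranch, fanoutFn_apply, length_boolPair]
    have h1 : (succKF r).length ≤ (nthF 2 z).length + 2 := by rw [← f2]; exact length_succKF_le r
    have h2 := length_redLoopF_le (boolPair (nthF 0 r) (boolPair (nthF 1 r) (boolPair (nthF 2 r) (nthF 5 r))))
    simp only [sndPow_succ_boolPair, sndPow_zero, sndF_boolPair, fstF_boolPair, f0] at h2
    simp only [Function.comp_apply, fanoutFn_apply, f0]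
    nlinarith
  have helse : (elseBranch r).length ≤ 2 * (nthF 2 z).length + (sndPow 2 z).length + (redGrowth.eval (fstF z).length + 4 * (fstF z).length + 8) := by
    rw [elseBranch, fanoutFn_apply, length_boolPair]
    have h1 : (iteFn (isNilFn ∘ nthF 3) (fun _ => encodeNat 1) (nthF 3) r).length ≤ (nthF 2 z).length + 1 := by
      rw [iteFn_of_oneBit (oneBit_isNilFn.comp _)]
      split_ifs
      · show (encodeNat 1).length ≤ _; simp [show (encodeNat 1).length = 1 by decide]
      · rw [f3]; omega
    have h2 := length_swapAdjLF_le (boolPair (nthF 0 r) (boolPair (nthF 3 r) (nthF 5 r)))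
    simp only [sndPow_succ_boolPair, sndPow_zero, sndF_boolPair, fstF_boolPair, f0] at h2
    simp only [Function.comp_apply, fanoutFn_apply, f0]
    omega
  have hidle : (fanoutFn (nthF 2) (nthF 4) r).length ≤ 2 * (nthF 2 z).length + (sndPow 2 z).length + 2 := by
    rw [fanoutFn_apply, length_boolPair, f2, f4]; omega
  have hone : (fanoutFn (fun _ => encodeNat 1) (nthF 4) r).length ≤ 2 * (nthF 2 z).length + (sndPow 2 z).length + 4 := by
    rw [fanoutFn_apply, length_boolPair, f4]; simp [show (encodeNat 1).length = 1 by decide]; omega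
  have key : (capStepCore r).length ≤ 2 * (nthF 2 z).length + (sndPow 2 z).length + stepGrowth.eval (fstF z).length := by
    simp only [stepGrowth, eval_add, eval_mul, eval_ofNat, eval_X, eval_one]
    rw [capStepCore, iteFn_of_oneBit (oneBit_ltFn.comp _)]
    split_ifs
    · rw [iteFn_of_oneBit (oneBit_ltFn.comp _)]
      split_ifs
      · rw [runningF, iteFn_of_oneBit oneBit_lovTest]
        split_ifs
        · nlinarith
        · nlinarith
      · nlinarith
    · rw [iteFn_of_oneBit (oneBit_ltFn.comp _)]
      split_ifs
      · nlinarith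
      · nlinarith
  rw [capStepF, Function.comp_apply, Function.comp_apply, ← hr]
  omega

end LLLMachine

end Literature.Algebra.EuclideanLattices
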